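import Literature.AlgebraicGeometry.Modules.LinearOverBase
import Literature.AlgebraicGeometry.Motives.ChernClassesProofs
import Mathlib.CategoryTheory.Limits.Preserves.Shapes.Kernels
import HarnessLib

/-!
# Cokernels of multiplication by a global function restrict to open subschemes

Helper file for stub `stub_pushforwardTransport` (line `chow-zariski-pushforward` of the crux
`PadicSemiregularLift.FormalVectorBundlesAlgebraize`, stmt-HodgeConjecture-14106).

For an `𝒪_Y`-module `E`, a global function `q ∈ Γ(Y, 𝒪_Y)` and an open `X ⊆ Y`, restriction to
the open subscheme `X` (Mathlib `Scheme.Modules.restrictFunctor X.ι`, a left adjoint) carries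
multiplication by `q` on `E` (tree `globalScalar`) to multiplication by `q|_X` on `E|_X`
(`restrictFunctor_map_globalScalar`) and the cokernel `E/qE` to the cokernel `E|_X / q E|_X`,
compatibly with the projections (`exists_restrict_cokernelIso`) and with the reduction maps
between two such cokernels (`restrict_map_reduction`). Consequence used by the transport stub
(`lift_sections_of_lift_restrict`): a lifting statement for sections of `E|_X / q E|_X` over the
whole open subscheme (the shape of the module Bockstein lemma) yields the same statement for the
sections of `E/qE` over the open `X`.

Everything is proved; no definitions.

Provenance: Literature home (family `hodge`, layer `Literature/AlgebraicGeometry/FormalGeometry`, namespace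
`Literature.AlgebraicGeometry.FormalGeometry.WittGrothendieckExistence…`) of the Summits-side
`Theorems/PadicSemiregularLiftFormalVectorBundlesAlgebraizeCokernelRestrict` (route `PadicSemiregularLift` / `AnchorTransport`,
Grothendieck existence for vector bundles over `W(k)`), which `Literature/` may not import; theorems only, no
named fact, no definition. Lane `lit-hodgefound`, seat p20.
-/

noncomputable section

open CategoryTheory CategoryTheory.Limits _root_.AlgebraicGeometry TopologicalSpace Opposite
open Literature.AlgebraicGeometry.Modules Literature.AlgebraicGeometry.Motives

universe u

namespace Literature.AlgebraicGeometry.FormalGeometry.WittGrothendieckExistence.FormalVectorBundlesAlgebraize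

variable {Y : Scheme.{u}} (X : Y.Opens) (E : Y.Modules)

/-- Restriction of a morphism to an open subscheme, on sections. [cite: GortzWedhorn2023, proof of Thm. 24.94 and Prop. 24.95 (pp. 566–567), auxiliary step] -/
theorem restrictFunctor_map_app' {M N : Y.Modules} (ψ : M ⟶ N) (O : (X : Scheme.{u}).Opens)
    (y : Γ((Scheme.Modules.restrictFunctor X.ι).obj M, O)) :
    ((Scheme.Modules.restrictFunctor X.ι).map ψ).app O y =
      ψ.app (X.ι ''ᵁ O) (show Γ(M, X.ι ''ᵁ O) from y) :=
  rfl

/-- **Restriction carries multiplication by `q` to multiplication by `q|_X`.** [cite: GortzWedhorn2023, proof of Thm. 24.94 and Prop. 24.95 (pp. 566–567), auxiliary step] -/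
theorem restrictFunctor_map_globalScalar (q : Γ(Y, ⊤)) (qX : Γ((X : Scheme.{u}), ⊤))
    (hq : qX = Y.presheaf.map (homOfLE le_top).op q) :
    (Scheme.Modules.restrictFunctor X.ι).map (globalScalar E q) =
      globalScalar ((Scheme.Modules.restrictFunctor X.ι).obj E) qX := by
  subst hq
  refine Scheme.Modules.hom_ext _ _ fun O => ?_
  ext y
  change ((Scheme.Modules.restrictFunctor X.ι).map (globalScalar E q)).app O y =
    (globalScalar ((Scheme.Modules.restrictFunctor X.ι).obj E) _).app O y
  rw [restrictFunctor_map_app', globalScalar_app_apply, globalScalar_app_apply]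
  change _ = ((X.ι.appIso O).inv ((X : Scheme.{u}).presheaf.map (homOfLE le_top).op
    (Y.presheaf.map (homOfLE le_top).op q))) • (show Γ(E, X.ι ''ᵁ O) from y)
  rw [Scheme.Opens.ι_appIso]
  change _ = (Y.presheaf.map _ (Y.presheaf.map _ q)) • (show Γ(E, X.ι ''ᵁ O) from y)
  rw [← CategoryTheory.comp_apply, ← Functor.map_comp]
  rfl

/-- **Restriction carries `E/qE` to `E|_X / q E|_X`**, compatibly with the projections. [cite: GortzWedhorn2023, proof of Thm. 24.94 and Prop. 24.95 (pp. 566–567), auxiliary step] -/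
theorem exists_restrict_cokernelIso (q : Γ(Y, ⊤)) (qX : Γ((X : Scheme.{u}), ⊤))
    (hq : qX = Y.presheaf.map (homOfLE le_top).op q) :
    ∃ e : (Scheme.Modules.restrictFunctor X.ι).obj (cokernel (globalScalar E q)) ≅
        cokernel (globalScalar ((Scheme.Modules.restrictFunctor X.ι).obj E) qX),
      (Scheme.Modules.restrictFunctor X.ι).map (cokernel.π (globalScalar E q)) ≫ e.hom =
        cokernel.π _ := by
  refine ⟨PreservesCokernel.iso (Scheme.Modules.restrictFunctor X.ι) (globalScalar E q) ≪≫
    cokernelIsoOfEq (restrictFunctor_map_globalScalar X E q qX hq), ?_⟩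
  rw [Iso.trans_hom, ← Category.assoc, PreservesCokernel.π_iso_hom, π_comp_cokernelIsoOfEq_hom]

/-- Restriction of reduction maps: if `r : E/q_aE → E/q_bE` and `r' : E|_X/q_a → E|_X/q_b` are
compatible with the projections, they correspond under the isomorphisms of
`exists_restrict_cokernelIso`. [cite: GortzWedhorn2023, proof of Thm. 24.94 and Prop. 24.95 (pp. 566–567), auxiliary step] -/
theorem restrict_map_reduction {qa qb : Γ(Y, ⊤)} {qaX qbX : Γ((X : Scheme.{u}), ⊤)}
    (ea : (Scheme.Modules.restrictFunctor X.ι).obj (cokernel (globalScalar E qa)) ≅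
      cokernel (globalScalar ((Scheme.Modules.restrictFunctor X.ι).obj E) qaX))
    (hea : (Scheme.Modules.restrictFunctor X.ι).map (cokernel.π (globalScalar E qa)) ≫ ea.hom =
      cokernel.π _)
    (eb : (Scheme.Modules.restrictFunctor X.ι).obj (cokernel (globalScalar E qb)) ≅
      cokernel (globalScalar ((Scheme.Modules.restrictFunctor X.ι).obj E) qbX))
    (heb : (Scheme.Modules.restrictFunctor X.ι).map (cokernel.π (globalScalar E qb)) ≫ eb.hom =
      cokernel.π _)
    (r : cokernel (globalScalar E qa) ⟶ cokernel (globalScalar E qb))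
    (hr : cokernel.π (globalScalar E qa) ≫ r = cokernel.π (globalScalar E qb))
    (r' : cokernel (globalScalar ((Scheme.Modules.restrictFunctor X.ι).obj E) qaX) ⟶
      cokernel (globalScalar ((Scheme.Modules.restrictFunctor X.ι).obj E) qbX))
    (hr' : cokernel.π _ ≫ r' = cokernel.π _) :
    (Scheme.Modules.restrictFunctor X.ι).map r ≫ eb.hom = ea.hom ≫ r' := by
  haveI : Epi ((Scheme.Modules.restrictFunctor X.ι).map (cokernel.π (globalScalar E qa))) :=
    inferInstance
  rw [← cancel_epi ((Scheme.Modules.restrictFunctor X.ι).map (cokernel.π (globalScalar E qa))),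
    ← Category.assoc, ← Functor.map_comp, hr, heb, ← Category.assoc, hea, hr']

/-- Restricting a section along `X ≤ X.ι '' ⊤ ≤ X` gives it back. [cite: GortzWedhorn2023, proof of Thm. 24.94 and Prop. 24.95 (pp. 566–567), auxiliary step] -/
theorem map_map_ι_image_top (M : Y.Modules) (x : Γ(M, X)) :
    M.presheaf.map (homOfLE (X.ι_image_top).ge).op
      (M.presheaf.map (homOfLE (X.ι_image_top).le).op x) = x := by
  rw [← CategoryTheory.comp_apply, ← Functor.map_comp]
  change M.presheaf.map (homOfLE (X.ι_image_top).ge ≫ homOfLE (X.ι_image_top).le).op x = x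
  rw [Subsingleton.elim (homOfLE (X.ι_image_top).ge ≫ homOfLE (X.ι_image_top).le) (𝟙 X)]
  change (M.presheaf.map (𝟙 (op X))) x = x
  rw [CategoryTheory.Functor.map_id]
  rfl

/-- Restricting a section along `X.ι '' ⊤ ≤ X ≤ X.ι '' ⊤` gives it back. [cite: GortzWedhorn2023, proof of Thm. 24.94 and Prop. 24.95 (pp. 566–567), auxiliary step] -/
theorem map_map_ι_image_top' (M : Y.Modules) (x : Γ(M, X.ι ''ᵁ ⊤)) :
    M.presheaf.map (homOfLE (X.ι_image_top).le).op
      (M.presheaf.map (homOfLE (X.ι_image_top).ge).op x) = x := by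
  rw [← CategoryTheory.comp_apply, ← Functor.map_comp]
  change M.presheaf.map (homOfLE (X.ι_image_top).le ≫ homOfLE (X.ι_image_top).ge).op x = x
  rw [Subsingleton.elim (homOfLE (X.ι_image_top).le ≫ homOfLE (X.ι_image_top).ge) (𝟙 _)]
  change (M.presheaf.map (𝟙 (op (X.ι ''ᵁ ⊤)))) x = x
  rw [CategoryTheory.Functor.map_id]
  rfl

/-- **Lifting sections: from the open subscheme to the open.** If every global section of
`E|_X / q_a E|_X` reduces, in `E|_X / q_b E|_X`, to the class of a global section of `E|_X`
(the shape of the module Bockstein lemma on the open subscheme `X`), then every section of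
`E / q_a E` over the open `X` reduces, in `E / q_b E`, to the class of a section of `E` over `X`. [cite: GortzWedhorn2023, proof of Thm. 24.94 and Prop. 24.95 (pp. 566–567), auxiliary step] -/
theorem lift_sections_of_lift_restrict {qa qb : Γ(Y, ⊤)} {qaX qbX : Γ((X : Scheme.{u}), ⊤)}
    (ea : (Scheme.Modules.restrictFunctor X.ι).obj (cokernel (globalScalar E qa)) ≅
      cokernel (globalScalar ((Scheme.Modules.restrictFunctor X.ι).obj E) qaX))
    (hea : (Scheme.Modules.restrictFunctor X.ι).map (cokernel.π (globalScalar E qa)) ≫ ea.hom =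
      cokernel.π _)
    (eb : (Scheme.Modules.restrictFunctor X.ι).obj (cokernel (globalScalar E qb)) ≅
      cokernel (globalScalar ((Scheme.Modules.restrictFunctor X.ι).obj E) qbX))
    (heb : (Scheme.Modules.restrictFunctor X.ι).map (cokernel.π (globalScalar E qb)) ≫ eb.hom =
      cokernel.π _)
    (r : cokernel (globalScalar E qa) ⟶ cokernel (globalScalar E qb))
    (hr : cokernel.π (globalScalar E qa) ≫ r = cokernel.π (globalScalar E qb))
    (r' : cokernel (globalScalar ((Scheme.Modules.restrictFunctor X.ι).obj E) qaX) ⟶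
      cokernel (globalScalar ((Scheme.Modules.restrictFunctor X.ι).obj E) qbX))
    (hr' : cokernel.π _ ≫ r' = cokernel.π _)
    (hlift : ∀ t' : Γ(cokernel (globalScalar ((Scheme.Modules.restrictFunctor X.ι).obj E) qaX), ⊤),
      ∃ s' : Γ((Scheme.Modules.restrictFunctor X.ι).obj E, ⊤),
        (cokernel.π (globalScalar ((Scheme.Modules.restrictFunctor X.ι).obj E) qbX)).app ⊤ s' =
          r'.app ⊤ t')
    (t : Γ(cokernel (globalScalar E qa), X)) :
    ∃ s : Γ(E, X), (cokernel.π (globalScalar E qb)).app X s = r.app X t := by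
  let R := Scheme.Modules.restrictFunctor X.ι
  -- move `t` to the open subscheme and lift there
  let t₁ : Γ(R.obj (cokernel (globalScalar E qa)), ⊤) :=
    (cokernel (globalScalar E qa)).presheaf.map (homOfLE (X.ι_image_top).le).op t
  obtain ⟨s', hs'⟩ := hlift (ea.hom.app ⊤ t₁)
  refine ⟨E.presheaf.map (homOfLE (X.ι_image_top).ge).op (show Γ(E, X.ι ''ᵁ ⊤) from s'), ?_⟩
  -- compare after moving back to the open subscheme and applying `eb`
  have hinj₁ : Function.Injective
      ((cokernel (globalScalar E qb)).presheaf.map (homOfLE (X.ι_image_top).le).op) :=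
    fun x y hxy => by
      rw [← map_map_ι_image_top X (cokernel (globalScalar E qb)) x,
        ← map_map_ι_image_top X (cokernel (globalScalar E qb)) y, hxy]
  have hinj₂ : Function.Injective (eb.hom.app ⊤) := fun x y hxy => by
    have h := congrArg (eb.inv.app ⊤) hxy
    change (eb.hom ≫ eb.inv).app ⊤ x = (eb.hom ≫ eb.inv).app ⊤ y at h
    rwa [eb.hom_inv_id] at h
  apply hinj₁
  apply hinj₂
  -- left-hand side: the class of `s'`
  have lhs : eb.hom.app ⊤ ((cokernel (globalScalar E qb)).presheaf.map
      (homOfLE (X.ι_image_top).le).op ((cokernel.π (globalScalar E qb)).app X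
        (E.presheaf.map (homOfLE (X.ι_image_top).ge).op (show Γ(E, X.ι ''ᵁ ⊤) from s')))) =
      r'.app ⊤ (ea.hom.app ⊤ t₁) := by
    rw [← hs', ← Scheme.Modules.Hom.app_map_apply, map_map_ι_image_top']
    change (R.map (cokernel.π (globalScalar E qb)) ≫ eb.hom).app ⊤ s' = _
    rw [heb]
  -- right-hand side: the reduction of `t`
  have rhs : eb.hom.app ⊤ ((cokernel (globalScalar E qb)).presheaf.map
      (homOfLE (X.ι_image_top).le).op (r.app X t)) = r'.app ⊤ (ea.hom.app ⊤ t₁) := by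
    rw [← Scheme.Modules.Hom.app_map_apply]
    change (R.map r ≫ eb.hom).app ⊤ t₁ = (ea.hom ≫ r').app ⊤ t₁
    rw [restrict_map_reduction X E ea hea eb heb r hr r' hr']
  rw [lhs, rhs]

/-! ### Reduction maps `E/q'E → E/qE` for `q ∣ q'`, and enlarging the Bockstein exponent -/

section Reduction

variable {X' : Scheme.{u}} (M : X'.Modules)

/-- For `q' = d q` there is a reduction map `M/q'M → M/qM` under `M`. [cite: GortzWedhorn2023, proof of Thm. 24.94 and Prop. 24.95 (pp. 566–567), auxiliary step] -/
theorem exists_reduction {q q' d : Γ(X', ⊤)} (hd : q' = d * q) :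
    ∃ r : cokernel (globalScalar M q') ⟶ cokernel (globalScalar M q),
      cokernel.π (globalScalar M q') ≫ r = cokernel.π (globalScalar M q) := by
  refine ⟨cokernel.desc _ (cokernel.π (globalScalar M q)) ?_, cokernel.π_desc _ _ _⟩
  rw [hd, mul_comm, globalScalar_mul, Category.assoc, cokernel.condition, comp_zero]

/-- Reduction maps under `M` are unique. [cite: GortzWedhorn2023, proof of Thm. 24.94 and Prop. 24.95 (pp. 566–567), auxiliary step] -/
theorem reduction_unique {q q' : Γ(X', ⊤)} (r₁ r₂ : cokernel (globalScalar M q') ⟶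
      cokernel (globalScalar M q))
    (h₁ : cokernel.π (globalScalar M q') ≫ r₁ = cokernel.π (globalScalar M q))
    (h₂ : cokernel.π (globalScalar M q') ≫ r₂ = cokernel.π (globalScalar M q)) : r₁ = r₂ := by
  rw [← cancel_epi (cokernel.π (globalScalar M q')), h₁, h₂]

/-- **Enlarging the exponent in a Bockstein-type lifting statement.** Let `g : ℕ → Γ(X, 𝒪_X)` be
multiplicative in the sense `g m' ∈ g m · Γ` for `m ≤ m'` (e.g. `g m = a^m`). If global sections
of `M / g(n+1+c₀) M` reduce to classes of global sections of `M` in `M / g(n+1) M` for all `n`,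
then the same holds with any `c ≥ c₀` in place of `c₀`. [cite: GortzWedhorn2023, proof of Thm. 24.94 and Prop. 24.95 (pp. 566–567), auxiliary step] -/
theorem lift_of_le_exponent (g : ℕ → Γ(X', ⊤))
    (hg : ∀ m m' : ℕ, m ≤ m' → ∃ d : Γ(X', ⊤), g m' = d * g m) {c₀ c : ℕ} (hc : c₀ ≤ c)
    (H : ∀ (n : ℕ) (r : cokernel (globalScalar M (g (n + 1 + c₀))) ⟶
        cokernel (globalScalar M (g (n + 1)))),
      cokernel.π (globalScalar M (g (n + 1 + c₀))) ≫ r = cokernel.π (globalScalar M (g (n + 1))) →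
      ∀ t : Γ(cokernel (globalScalar M (g (n + 1 + c₀))), ⊤), ∃ s : Γ(M, ⊤),
        (cokernel.π (globalScalar M (g (n + 1)))).app ⊤ s = r.app ⊤ t)
    (n : ℕ) (r : cokernel (globalScalar M (g (n + 1 + c))) ⟶ cokernel (globalScalar M (g (n + 1))))
    (hr : cokernel.π (globalScalar M (g (n + 1 + c))) ≫ r = cokernel.π (globalScalar M (g (n + 1))))
    (t : Γ(cokernel (globalScalar M (g (n + 1 + c))), ⊤)) :
    ∃ s : Γ(M, ⊤), (cokernel.π (globalScalar M (g (n + 1)))).app ⊤ s = r.app ⊤ t := by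
  obtain ⟨d₁, hd₁⟩ := hg (n + 1 + c₀) (n + 1 + c) (by omega)
  obtain ⟨d₂, hd₂⟩ := hg (n + 1) (n + 1 + c₀) (by omega)
  obtain ⟨r₁, hr₁⟩ := exists_reduction M hd₁
  obtain ⟨r₂, hr₂⟩ := exists_reduction M hd₂
  have hrr : r = r₁ ≫ r₂ :=
    reduction_unique M _ _ hr (by rw [← Category.assoc, hr₁, hr₂])
  obtain ⟨s, hs⟩ := H n r₂ hr₂ (r₁.app ⊤ t)
  exact ⟨s, by rw [hs, hrr]; rfl⟩

end Reduction

/-! ### Registered sub-goal -/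

/-- **Registered sub-goal** (helper stub of `stub_pushforwardTransport`, universe `0`): restriction
to an open subscheme carries multiplication by a global function `q` to multiplication by `q|_X`
(`restrictFunctor_map_globalScalar`). [cite: GortzWedhorn2023, proof of Thm. 24.94 and Prop. 24.95 (pp. 566–567), auxiliary step] -/
theorem stub_restrictGlobalScalar :
    ∀ (Y : AlgebraicGeometry.Scheme.{0}) (X : Y.Opens) (E : Y.Modules)
      (q : Y.presheaf.obj (Opposite.op ⊤)),
      (AlgebraicGeometry.Scheme.Modules.restrictFunctor X.ι).map
          (Literature.AlgebraicGeometry.Modules.globalScalar E q) =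
        Literature.AlgebraicGeometry.Modules.globalScalar
          ((AlgebraicGeometry.Scheme.Modules.restrictFunctor X.ι).obj E)
          (Y.presheaf.map (CategoryTheory.homOfLE (le_top : X.ι ''ᵁ ⊤ ≤ ⊤)).op q) :=
  fun _ X E q => restrictFunctor_map_globalScalar X E q _ rfl

end Literature.AlgebraicGeometry.FormalGeometry.WittGrothendieckExistence.FormalVectorBundlesAlgebraize

end
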